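import Mathlib
import Summits.Ventures.PercRepro2.CutTwoFarRoots
import Summits.Ventures.PercRepro2.LeafStep

/-!
# `o`, `b` and `v` together behind a cut vertex (both roots on the other side): row (LEAF-½) is a
product of probabilities (blind cell PercRepro2, p5 g29; `proofs/P5-OEDGE.md` §39)

typer-1's machinery for both roots behind a cut vertex (`CutTwoFarRootsLaw.lean`,
`CutTwoFarRoots.lean`: the left pattern of `{v, a₁, a₂}` and the three right bits of `o, a₃, b`,
every mass a bilinear form in the five pattern probabilities `q` and the eight right atoms `α`)
carries the middle Bernstein coefficient `R½` (`LeafStep.Rhalf`; `a₃` = the attachment vertex of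
the row, the cut vertex = typer-1's `v`) exactly as it carries `Gc`:

  **`Rhalf_rootsFar_eq`**: with `a₁, a₂` on the left and `o, a₃, b` on the right (or at `v`),
  `R½ = 2 · P(Q) · P_A(a₁ ↔ v, a₂ ↮ v) · P_A(a₂ ↔ v, a₁ ↮ v) · P_B(v ↔ b) · (P_B(v ↔ o) + P_B(v ↔ o, v ↮ a₃))`

— a product of probabilities (compare `CutTwoFar.Gc_rootsFar_eq`), no Harris / BHK input; hence
the row on the whole class (**`LeafRow_rootsFar`**), every admissible weight vector, every
weighted part on either side.  The four extra masses of `R½` (`mUo_roots` … `mUU_roots`, generated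
by own code) and `P_B(v ↔ o)` (`o_roots`) as forms in `q` and `α`; the identity is `∑ α = 1` and
`ring`.  Own work; standard axioms.
-/

namespace Summit.Ventures.PercRepro2

open CovForm CutVertexM9 UnionCluster CutTwoFar LeafStep

namespace LeafRowCutTwoFar

section Roots

variable {V : Type*} {E : Type*} [Fintype E] [DecidableEq E] {R : Type*} [Field R]
variable {ends : E → Sym2 V} {side : E → Bool} {L : Set V} {v : V} {Rt : Set V}

/-- `mU(o)` with both roots behind the cut vertex, as a bilinear form in `q` and `α`. -/
theorem mUo_roots (h : CutVertex ends side L v Rt) {a₁ a₂ : V} (h₁ : a₁ ∈ L ∨ a₁ = v) (h₂ : a₂ ∈ L ∨ a₂ = v) {o a₃ b : V} (p : E → R) (ho : o ∈ Rt ∨ o = v) : mU p ends a₁ a₂ o =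
    (patProb ends side v a₁ a₂ p ![true, false, false] + patProb ends side v a₁ a₂ p ![false, true, false]) * (atom ends side v o a₃ b p (true, (true, true)) + atom ends side v o a₃ b p (true, (true, false)) + atom ends side v o a₃ b p (true, (false, true)) + atom ends side v o a₃ b p (true, (false, false))) := by
  simp only [mU]
  rw [prob_pat_R ends side v o a₃ b a₁ a₂ p (avoidAll ends a₂ {a₁} ∩ connEvent ends a₁ o)
      (fun τ ρ => (¬ (τ 2 = true) ∧ (τ 0 = true ∧ ρ.1 = true))) (fun ω => by simp only [Set.mem_inter_iff, mem_connEvent, Rbits, avoidAll, Set.mem_setOf_eq, Finset.mem_singleton, forall_eq, conn_a₂_a₁_iff h h₁ h₂ ω, conn_a₁_iff h h₁ ho ω (a₂ := a₂)]),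
    prob_pat_R ends side v o a₃ b a₁ a₂ p (avoidAll ends a₂ {a₁} ∩ connEvent ends a₂ o)
      (fun τ ρ => (¬ (τ 2 = true) ∧ (τ 1 = true ∧ ρ.1 = true))) (fun ω => by simp only [Set.mem_inter_iff, mem_connEvent, Rbits, avoidAll, Set.mem_setOf_eq, Finset.mem_singleton, forall_eq, conn_a₂_a₁_iff h h₁ h₂ ω, conn_a₂_iff h h₂ ho ω (a₁ := a₁)])]
  simp only [mix_eq_sum_transPatterns, sum_transPatterns]
  conv_lhs => simp [Fintype.sum_prod_type]
  ring

/-- `mU(b)` with both roots behind the cut vertex. -/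
theorem mUb_roots (h : CutVertex ends side L v Rt) {a₁ a₂ : V} (h₁ : a₁ ∈ L ∨ a₁ = v) (h₂ : a₂ ∈ L ∨ a₂ = v) {o a₃ b : V} (p : E → R) (hb : b ∈ Rt ∨ b = v) : mU p ends a₁ a₂ b =
    (patProb ends side v a₁ a₂ p ![true, false, false] + patProb ends side v a₁ a₂ p ![false, true, false]) * (atom ends side v o a₃ b p (true, (true, true)) + atom ends side v o a₃ b p (true, (false, true)) + atom ends side v o a₃ b p (false, (true, true)) + atom ends side v o a₃ b p (false, (false, true))) := by
  simp only [mU]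
  rw [prob_pat_R ends side v o a₃ b a₁ a₂ p (avoidAll ends a₂ {a₁} ∩ connEvent ends a₁ b)
      (fun τ ρ => (¬ (τ 2 = true) ∧ (τ 0 = true ∧ ρ.2.2 = true))) (fun ω => by simp only [Set.mem_inter_iff, mem_connEvent, Rbits, avoidAll, Set.mem_setOf_eq, Finset.mem_singleton, forall_eq, conn_a₂_a₁_iff h h₁ h₂ ω, conn_a₁_iff h h₁ hb ω (a₂ := a₂)]),
    prob_pat_R ends side v o a₃ b a₁ a₂ p (avoidAll ends a₂ {a₁} ∩ connEvent ends a₂ b)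
      (fun τ ρ => (¬ (τ 2 = true) ∧ (τ 1 = true ∧ ρ.2.2 = true))) (fun ω => by simp only [Set.mem_inter_iff, mem_connEvent, Rbits, avoidAll, Set.mem_setOf_eq, Finset.mem_singleton, forall_eq, conn_a₂_a₁_iff h h₁ h₂ ω, conn_a₂_iff h h₂ hb ω (a₁ := a₁)])]
  simp only [mix_eq_sum_transPatterns, sum_transPatterns]
  conv_lhs => simp [Fintype.sum_prod_type]
  ring

/-- `mU(a₃)` with both roots behind the cut vertex. -/
theorem mUa3_roots (h : CutVertex ends side L v Rt) {a₁ a₂ : V} (h₁ : a₁ ∈ L ∨ a₁ = v) (h₂ : a₂ ∈ L ∨ a₂ = v) {o a₃ b : V} (p : E → R) (h3 : a₃ ∈ Rt ∨ a₃ = v) : mU p ends a₁ a₂ a₃ =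
    (patProb ends side v a₁ a₂ p ![true, false, false] + patProb ends side v a₁ a₂ p ![false, true, false]) * (atom ends side v o a₃ b p (true, (true, true)) + atom ends side v o a₃ b p (true, (true, false)) + atom ends side v o a₃ b p (false, (true, true)) + atom ends side v o a₃ b p (false, (true, false))) := by
  simp only [mU]
  rw [prob_pat_R ends side v o a₃ b a₁ a₂ p (avoidAll ends a₂ {a₁} ∩ connEvent ends a₁ a₃)
      (fun τ ρ => (¬ (τ 2 = true) ∧ (τ 0 = true ∧ ρ.2.1 = true))) (fun ω => by simp only [Set.mem_inter_iff, mem_connEvent, Rbits, avoidAll, Set.mem_setOf_eq, Finset.mem_singleton, forall_eq, conn_a₂_a₁_iff h h₁ h₂ ω, conn_a₁_iff h h₁ h3 ω (a₂ := a₂)]),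
    prob_pat_R ends side v o a₃ b a₁ a₂ p (avoidAll ends a₂ {a₁} ∩ connEvent ends a₂ a₃)
      (fun τ ρ => (¬ (τ 2 = true) ∧ (τ 1 = true ∧ ρ.2.1 = true))) (fun ω => by simp only [Set.mem_inter_iff, mem_connEvent, Rbits, avoidAll, Set.mem_setOf_eq, Finset.mem_singleton, forall_eq, conn_a₂_a₁_iff h h₁ h₂ ω, conn_a₂_iff h h₂ h3 ω (a₁ := a₁)])]
  simp only [mix_eq_sum_transPatterns, sum_transPatterns]
  conv_lhs => simp [Fintype.sum_prod_type]
  ring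

/-- `mUU` with both roots behind the cut vertex. -/
theorem mUU_roots (h : CutVertex ends side L v Rt) {a₁ a₂ : V} (h₁ : a₁ ∈ L ∨ a₁ = v) (h₂ : a₂ ∈ L ∨ a₂ = v) {o a₃ b : V} (p : E → R) (ho : o ∈ Rt ∨ o = v) (hb : b ∈ Rt ∨ b = v) : mUU p ends o a₁ a₂ b =
    (patProb ends side v a₁ a₂ p ![true, false, false] + patProb ends side v a₁ a₂ p ![false, true, false]) * (atom ends side v o a₃ b p (true, (true, true)) + atom ends side v o a₃ b p (true, (false, true))) := by
  simp only [mUU]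
  rw [prob_pat_R ends side v o a₃ b a₁ a₂ p (avoidAll ends a₂ {a₁} ∩ (connEvent ends a₁ o ∩ connEvent ends a₁ b))
      (fun τ ρ => (¬ (τ 2 = true) ∧ ((τ 0 = true ∧ ρ.1 = true) ∧ (τ 0 = true ∧ ρ.2.2 = true)))) (fun ω => by simp only [Set.mem_inter_iff, mem_connEvent, Rbits, avoidAll, Set.mem_setOf_eq, Finset.mem_singleton, forall_eq, conn_a₂_a₁_iff h h₁ h₂ ω, conn_a₁_iff h h₁ ho ω (a₂ := a₂), conn_a₁_iff h h₁ hb ω (a₂ := a₂)]),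
    prob_pat_R ends side v o a₃ b a₁ a₂ p (avoidAll ends a₂ {a₁} ∩ (connEvent ends a₂ o ∩ connEvent ends a₂ b))
      (fun τ ρ => (¬ (τ 2 = true) ∧ ((τ 1 = true ∧ ρ.1 = true) ∧ (τ 1 = true ∧ ρ.2.2 = true)))) (fun ω => by simp only [Set.mem_inter_iff, mem_connEvent, Rbits, avoidAll, Set.mem_setOf_eq, Finset.mem_singleton, forall_eq, conn_a₂_a₁_iff h h₁ h₂ ω, conn_a₂_iff h h₂ ho ω (a₁ := a₁), conn_a₂_iff h h₂ hb ω (a₁ := a₁)]),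
    prob_pat_R ends side v o a₃ b a₁ a₂ p (avoidAll ends a₂ {a₁} ∩ (connEvent ends a₂ o ∩ connEvent ends a₁ b))
      (fun τ ρ => (¬ (τ 2 = true) ∧ ((τ 1 = true ∧ ρ.1 = true) ∧ (τ 0 = true ∧ ρ.2.2 = true)))) (fun ω => by simp only [Set.mem_inter_iff, mem_connEvent, Rbits, avoidAll, Set.mem_setOf_eq, Finset.mem_singleton, forall_eq, conn_a₂_a₁_iff h h₁ h₂ ω, conn_a₂_iff h h₂ ho ω (a₁ := a₁), conn_a₁_iff h h₁ hb ω (a₂ := a₂)]),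
    prob_pat_R ends side v o a₃ b a₁ a₂ p (avoidAll ends a₂ {a₁} ∩ (connEvent ends a₁ o ∩ connEvent ends a₂ b))
      (fun τ ρ => (¬ (τ 2 = true) ∧ ((τ 0 = true ∧ ρ.1 = true) ∧ (τ 1 = true ∧ ρ.2.2 = true)))) (fun ω => by simp only [Set.mem_inter_iff, mem_connEvent, Rbits, avoidAll, Set.mem_setOf_eq, Finset.mem_singleton, forall_eq, conn_a₂_a₁_iff h h₁ h₂ ω, conn_a₁_iff h h₁ ho ω (a₂ := a₂), conn_a₂_iff h h₂ hb ω (a₁ := a₁)])]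
  simp only [mix_eq_sum_transPatterns, sum_transPatterns]
  conv_lhs => simp [Fintype.sum_prod_type]
  ring

/-- `P_B(v ↔ o)` as atoms. -/
lemma o_roots {o a₃ b : V} (p : E → R) :
    prob p {ω | Conn ends (CutVertexM9.restrict side false ω) v o} =
      ∑ ρ : Bool × Bool × Bool, if ρ.1 = true then atom ends side v o a₃ b p ρ else 0 :=
  prob_R ends side v o a₃ b p _ (fun ρ => ρ.1 = true)
    (fun ω => by simp only [Set.mem_setOf_eq, Rbits, Rb_eq_true_iff])

/-- **`R½` WITH BOTH ROOTS BEHIND THE CUT VERTEX IS A PRODUCT OF PROBABILITIES**: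
`R½ = 2 · P(Q) · q_x1 · q_x2 · P_B(v ↔ b) · (P_B(v ↔ o) + P_B(v ↔ o, v ↮ a₃))`,
`q_x1 = P_A(a₁ ↔ v, a₂ ↮ v)`, `q_x2 = P_A(a₂ ↔ v, a₁ ↮ v)`. -/
theorem Rhalf_rootsFar_eq [LinearOrder R] [IsStrictOrderedRing R] (h : CutVertex ends side L v Rt)
    {a₁ a₂ : V} (h₁ : a₁ ∈ L ∨ a₁ = v) (h₂ : a₂ ∈ L ∨ a₂ = v) {o a₃ b : V} (p : E → R)
    (ho : o ∈ Rt ∨ o = v) (h3 : a₃ ∈ Rt ∨ a₃ = v) (hb : b ∈ Rt ∨ b = v) :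
    Rhalf p ends o a₁ a₂ a₃ b =
      2 * prob p (avoidAll ends a₂ {a₁}) *
        patProb ends side v a₁ a₂ p ![true, false, false] *
        patProb ends side v a₁ a₂ p ![false, true, false] *
        prob p {ω | Conn ends (CutVertexM9.restrict side false ω) v b} *
        (prob p {ω | Conn ends (CutVertexM9.restrict side false ω) v o} +
          prob p {ω | Conn ends (CutVertexM9.restrict side false ω) v o ∧
            ¬ Conn ends (CutVertexM9.restrict side false ω) v a₃}) := by
  have hs := atom_sum ends side v o a₃ b p
  simp only [Fintype.sum_prod_type, Fintype.sum_bool] at hs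
  have hPQ : prob p (avoidAll ends a₂ {a₁}) =
      patProb ends side v a₁ a₂ p ![true, false, false] + patProb ends side v a₁ a₂ p ![false, true, false] +
        patProb ends side v a₁ a₂ p ![false, false, false] := by
    rw [PQ_roots (o := o) (a₃ := a₃) (b := b) h h₁ h₂ p]
    linear_combination (patProb ends side v a₁ a₂ p ![true, false, false] +
      patProb ends side v a₁ a₂ p ![false, true, false] + patProb ends side v a₁ a₂ p ![false, false, false]) * hs
  unfold Rhalf T0 Gc1
  rw [hPQ,
    EQbo_roots (a₃ := a₃) h h₁ h₂ p ho hb,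
    EQb3_roots (o := o) h h₁ h₂ p h3 hb,
    EQb3o_roots h h₁ h₂ p ho h3 hb,
    gap_roots (o := o) (a₃ := a₃) h h₁ h₂ p hb,
    EQo_roots (a₃ := a₃) (b := b) h h₁ h₂ p ho,
    EQ3_roots (o := o) (b := b) h h₁ h₂ p h3,
    EQ3o_roots (b := b) h h₁ h₂ p ho h3,
    PDb_roots (o := o) h h₁ h₂ p h3 hb,
    PDbo_roots h h₁ h₂ p ho h3 hb,
    Do_roots (b := b) h h₁ h₂ p ho h3,
    mUo_roots (a₃ := a₃) (b := b) h h₁ h₂ p ho,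
    mUb_roots (o := o) (a₃ := a₃) h h₁ h₂ p hb,
    mUa3_roots (o := o) (b := b) h h₁ h₂ p h3,
    mUU_roots (a₃ := a₃) h h₁ h₂ p ho hb,
    beta_roots (o := o) (a₃ := a₃) p, dO_roots (b := b) p, o_roots (a₃ := a₃) (b := b) p]
  conv_rhs => simp [Fintype.sum_prod_type]
  ring

/-- **Row (LEAF-½) with both roots behind a cut vertex** (`o`, `b` and the attachment vertex `a₃`
together on the other side), every admissible weight vector: a product of probabilities. -/
theorem LeafRow_rootsFar [LinearOrder R] [IsStrictOrderedRing R] (h : CutVertex ends side L v Rt)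
    {a₁ a₂ : V} (h₁ : a₁ ∈ L ∨ a₁ = v) (h₂ : a₂ ∈ L ∨ a₂ = v) {o a₃ b : V} {p : E → R}
    (hp : IsProbVec p) (ho : o ∈ Rt ∨ o = v) (h3 : a₃ ∈ Rt ∨ a₃ = v) (hb : b ∈ Rt ∨ b = v) :
    LeafRow p ends o a₁ a₂ a₃ b := by
  unfold LeafRow
  rw [Rhalf_rootsFar_eq h h₁ h₂ p ho h3 hb]
  have hq : ∀ τ, 0 ≤ patProb ends side v a₁ a₂ p τ := fun τ => prob_nonneg hp _
  have hPQ := prob_nonneg hp (avoidAll ends a₂ {a₁})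
  have hβ := prob_nonneg hp {ω | Conn ends (CutVertexM9.restrict side false ω) v b}
  have hO := prob_nonneg hp {ω | Conn ends (CutVertexM9.restrict side false ω) v o}
  have hd := prob_nonneg hp {ω | Conn ends (CutVertexM9.restrict side false ω) v o ∧
    ¬ Conn ends (CutVertexM9.restrict side false ω) v a₃}
  have h2 : (0 : R) ≤ 2 := by norm_num
  exact mul_nonneg (mul_nonneg (mul_nonneg (mul_nonneg (mul_nonneg h2 hPQ) (hq _)) (hq _)) hβ)
    (add_nonneg hO hd)

end Roots

end LeafRowCutTwoFar

end Summit.Ventures.PercRepro2
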